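import Summits.CriticalPhenomena.SAWScalingLimit.Theorems.SAWReversalUpgradeAttachmentExistsSqueezed

/-!
# The anchors of the standard attachment: access parameter `s₁`, exit parameter `r₁`,
# and the cut times `u₁`, `v₁`
# (route `SAWReversalUpgrade`, helper for item `AttachmentExists`, stmt-CriticalPhenomena-18009)

Continuation of `…AttachmentExistsSqueezed`. With `M = Z([i, j])`, `p = A (ψ (R i))`,
`q = A (ψ (R j))`, the route statement defines
`s₁ = sInf {s ∈ (0,1] | Φ (s p) ∈ M}` (first hit of `M` along the access segment),
`r₁ = sSup ({1} ∪ {r ≥ 1 | R j ≠ b ∧ Φ (r q) ∈ M})` (last hit along the exit ray),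
`u₁ = sInf {u ∈ [i,j] | Z u = Φ (s₁ p)}` and
`v₁ = sSup ({u ∈ [i,j] | R j = b ∧ u = j} ∪ {u ∈ [i,j] | R j ≠ b ∧ Z u = Φ (r₁ q)})`.
We prove that these infima/suprema are attained and record their defining properties
(`anc_*`), including the reduction of the middle piece `Z([u₁, v₁]) = Z([u₁, min v₁ τ])` to an
interval where `Z` is injective.

Folklore real analysis.
-/

noncomputable section

namespace Summit.CriticalPhenomena.SAWScalingLimit.Theorems

open Set Function Filter Topology
open scoped unitInterval

variable {D : Set ℂ} {a b p q : ℂ} {Φ A ψ : ℂ → ℂ} {e : ℝ} {P : C(I, ℂ)} {R Z : ℝ → ℂ}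
  {τ i j s₁ r₁ u₁ v₁ : ℝ}

/-! ### The access anchor `p` and the access parameter `s₁` -/

/-- `p = A (ψ (R i))` lies in `ℍ̄`, has the norm of `ψ (R i)`, vanishes iff `R i = a`, and
`Z i = Φ p`. [folklore] -/
theorem anc_p_spec (hR : ∀ u, R u = P (projIcc 0 1 zero_le_one u))
    (hZ : ∀ u, Z u = @ite ℂ (R u = b) (Classical.propDecidable _) b (Φ (A (ψ (R u)))))
    (hi : i = sSup ({(0 : ℝ)} ∪ {u | u ∈ Icc (0 : ℝ) 1 ∧ R u = a}))
    (hψ : ψ = invFunOn Φ {z : ℂ | 0 ≤ z.im}) (hΦi : InjOn Φ {z : ℂ | 0 ≤ z.im})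
    (hsurj : closure D \ {b} ⊆ Φ '' {z : ℂ | 0 ≤ z.im}) (hΦ0 : Φ 0 = a) (hab : a ≠ b)
    (hbD : b ∉ D) (hPcl : ∀ t, P t ∈ closure D) (hP0 : P 0 ∈ D) (he0 : 0 < e) (he1 : e ≤ 1 / 2)
    (hA : ∀ z, A z = (‖z‖ : ℂ) * Complex.exp (Complex.I * ((e : ℂ) +
      (1 - 2 * (e : ℂ) / (Real.pi : ℂ)) * (Complex.arg z : ℂ)))) (hp : p = A (ψ (R i))) :
    0 ≤ p.im ∧ ‖p‖ = ‖ψ (R i)‖ ∧ (p = 0 ↔ R i = a) ∧ (R i ≠ a → 0 < p.im) ∧ Z i = Φ p := by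
  have hmem := trim_R_i_mem hR hi hab hbD hPcl hP0
  have hRcl : ∀ u, R u ∈ closure D := trim_R_mem hR hPcl
  obtain ⟨him, -⟩ := sqd_psi_R hψ hsurj hRcl hmem.2
  have hzero : ψ (R i) = 0 ↔ R i = a := by subst hψ; exact inv_eq_zero_iff hΦi hsurj hΦ0 hmem
  subst hp
  refine ⟨sqz_im_nonneg he0 he1 hA him, sqz_norm hA _, by rw [sqz_eq_zero_iff hA, hzero],
    fun h => sqz_im_pos he0 he1 hA him fun h0 => h (hzero.1 h0), sqd_Z_of_ne hZ hmem.2⟩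

/-- **The access parameter `s₁` is attained**: `s₁ ∈ [0, 1]`, `Φ (s₁ p) ∈ M`, no earlier
positive parameter hits `M`; `s₁ = 0` exactly in the degenerate case `p = 0` (`R i = a`).
[folklore] -/
theorem anc_s_spec (hR : ∀ u, R u = P (projIcc 0 1 zero_le_one u))
    (hZ : ∀ u, Z u = @ite ℂ (R u = b) (Classical.propDecidable _) b (Φ (A (ψ (R u)))))
    (hi : i = sSup ({(0 : ℝ)} ∪ {u | u ∈ Icc (0 : ℝ) 1 ∧ R u = a}))
    (hj : j = sInf ({(1 : ℝ)} ∪ {u | u ∈ Icc (0 : ℝ) 1 ∧ R u = b}))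
    (hψ : ψ = invFunOn Φ {z : ℂ | 0 ≤ z.im}) (hΦc : ContinuousOn Φ {z : ℂ | 0 ≤ z.im})
    (hΦi : InjOn Φ {z : ℂ | 0 ≤ z.im})
    (hΦb : ∀ z : ℂ, 0 ≤ z.im → Φ z ≠ b)
    (hΦinf : Tendsto Φ (cocompact ℂ ⊓ 𝓟 {z : ℂ | 0 ≤ z.im}) (𝓝 b))
    (hsurj : closure D \ {b} ⊆ Φ '' {z : ℂ | 0 ≤ z.im}) (hΦ0 : Φ 0 = a)
    (hψc : ContinuousOn ψ (closure D \ {b})) (hab : a ≠ b)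
    (hbD : b ∉ D) (hPcl : ∀ t, P t ∈ closure D) (hP0 : P 0 ∈ D) (he0 : 0 < e) (he1 : e ≤ 1 / 2)
    (hA : ∀ z, A z = (‖z‖ : ℂ) * Complex.exp (Complex.I * ((e : ℂ) +
      (1 - 2 * (e : ℂ) / (Real.pi : ℂ)) * (Complex.arg z : ℂ)))) (hij : i ≤ j)
    (hp : p = A (ψ (R i)))
    (hs : s₁ = sInf {s | s ∈ Ioc (0 : ℝ) 1 ∧ Φ ((s : ℂ) * p) ∈ Z '' Icc i j}) :
    0 ≤ s₁ ∧ s₁ ≤ 1 ∧ Φ ((s₁ : ℂ) * p) ∈ Z '' Icc i j ∧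
      (∀ s : ℝ, 0 < s → s < s₁ → Φ ((s : ℂ) * p) ∉ Z '' Icc i j) ∧ (p ≠ 0 ∨ s₁ = 0) ∧
      (p = 0 → s₁ = 0) := by
  have hRcl : ∀ u, R u ∈ closure D := trim_R_mem hR hPcl
  obtain ⟨him, -, hp0, hpos, hZi⟩ :=
    anc_p_spec hR hZ hi hψ hΦi hsurj hΦ0 hab hbD hPcl hP0 he0 he1 hA hp
  have haM := sqd_a_mem_M_iff hR hZ hi hj hψ hΦi hsurj hΦ0 hRcl he0 he1 hA hij
  by_cases hpa : p = 0
  · -- degenerate case: the whole parameter set is `(0, 1]`, `s₁ = 0`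
    have hRia : R i = a := hp0.1 hpa
    have hset : {s | s ∈ Ioc (0 : ℝ) 1 ∧ Φ ((s : ℂ) * p) ∈ Z '' Icc i j} = Ioc 0 1 := by
      ext s
      simp only [mem_setOf_eq, and_iff_left_iff_imp]
      intro _
      rw [hpa, mul_zero, hΦ0]
      exact haM.2 hRia
    have hs0 : s₁ = 0 := by rw [hs, hset, csInf_Ioc zero_lt_one]
    refine ⟨hs0.ge, by rw [hs0]; exact zero_le_one, ?_, fun s h0 h1 => ?_, Or.inr hs0,
      fun _ => hs0⟩
    · rw [hs0, hpa, mul_zero, hΦ0]; exact haM.2 hRia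
    · rw [hs0] at h1; linarith
  · -- non-degenerate case: the parameter set is closed, bounded below by some `η > 0`
    have hRia : R i ≠ a := fun h => hpa (hp0.2 h)
    have haM' : a ∉ Z '' Icc i j := fun h => hRia (haM.1 h)
    have hMc : IsClosed (Z '' Icc i j) :=
      (isCompact_Icc.image_of_continuousOn (sqd_Z_continuousOn hR hZ hi hj hψ hΦc hΦb hΦinf
        hsurj hψc hRcl hbD hP0 he0 he1 hA)).isClosed
    set g : ℝ → ℂ := fun s => Φ ((s : ℂ) * p) with hg
    have hgc : ContinuousOn g (Ici 0) := ray_continuousOn hΦc him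
    have hg0 : g 0 = a := by simp [hg, hΦ0]
    -- near `0` the segment misses `M`
    obtain ⟨η, hη0, hη⟩ : ∃ η > 0, ∀ s ∈ Ico (0 : ℝ) η, g s ∉ Z '' Icc i j := by
      have h1 : g ⁻¹' (Z '' Icc i j)ᶜ ∈ 𝓝[Ici (0 : ℝ)] 0 :=
        (hgc 0 self_mem_Ici).preimage_mem_nhdsWithin
          (hMc.isOpen_compl.mem_nhds (by rw [mem_compl_iff, hg0]; exact haM'))
      obtain ⟨η, hη0, hsub⟩ := mem_nhdsGE_iff_exists_Ico_subset.1 h1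
      exact ⟨η, hη0, fun s hs => hsub hs⟩
    set S : Set ℝ := {s | s ∈ Ioc (0 : ℝ) 1 ∧ Φ ((s : ℂ) * p) ∈ Z '' Icc i j} with hS
    have h1S : (1 : ℝ) ∈ S := ⟨⟨zero_lt_one, le_rfl⟩, by
      rw [Complex.ofReal_one, one_mul, ← hZi]; exact ⟨i, ⟨le_rfl, hij⟩, rfl⟩⟩
    have hSη : ∀ s ∈ S, η ≤ s := fun s hs => by
      by_contra h
      exact hη s ⟨hs.1.1.le, not_le.1 h⟩ hs.2
    have hSeq : S = Icc η 1 ∩ g ⁻¹' (Z '' Icc i j) := by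
      ext s
      refine ⟨fun h => ⟨⟨hSη s h, h.1.2⟩, h.2⟩, fun h => ⟨⟨hη0.trans_le h.1.1, h.1.2⟩, h.2⟩⟩
    have hSc : IsClosed S := by
      rw [hSeq]
      exact (hgc.mono fun s (hs' : s ∈ Icc η 1) => show s ∈ Ici (0 : ℝ) from
        hη0.le.trans hs'.1).preimage_isClosed_of_isClosed isClosed_Icc hMc
    have hne : S.Nonempty := ⟨1, h1S⟩
    have hbdd : BddBelow S := ⟨0, fun s hs => hs.1.1.le⟩
    have hmem : s₁ ∈ S := hs ▸ hSc.csInf_mem hne hbdd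
    refine ⟨hmem.1.1.le, hmem.1.2, hmem.2, fun s h0 h1 hsM => ?_, Or.inl hpa,
      fun h => absurd h hpa⟩
    have : s₁ ≤ s := hs ▸ csInf_le hbdd ⟨⟨h0, h1.le.trans hmem.1.2⟩, hsM⟩
    linarith

/-- **The cut time `u₁` is attained**: `u₁ ∈ [i, j]`, `Z u₁ = Φ (s₁ p)`, `u₁` is the least
such time, and `u₁ ≤ τ`. [folklore] -/
theorem anc_u_spec (hR : ∀ u, R u = P (projIcc 0 1 zero_le_one u))
    (hZ : ∀ u, Z u = @ite ℂ (R u = b) (Classical.propDecidable _) b (Φ (A (ψ (R u)))))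
    (hi : i = sSup ({(0 : ℝ)} ∪ {u | u ∈ Icc (0 : ℝ) 1 ∧ R u = a}))
    (hj : j = sInf ({(1 : ℝ)} ∪ {u | u ∈ Icc (0 : ℝ) 1 ∧ R u = b}))
    (hψ : ψ = invFunOn Φ {z : ℂ | 0 ≤ z.im}) (hΦc : ContinuousOn Φ {z : ℂ | 0 ≤ z.im})
    (hΦb : ∀ z : ℂ, 0 ≤ z.im → Φ z ≠ b)
    (hΦinf : Tendsto Φ (cocompact ℂ ⊓ 𝓟 {z : ℂ | 0 ≤ z.im}) (𝓝 b))
    (hsurj : closure D \ {b} ⊆ Φ '' {z : ℂ | 0 ≤ z.im})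
    (hψc : ContinuousOn ψ (closure D \ {b}))
    (hbD : b ∉ D) (haD : a ∉ D) (hPcl : ∀ t, P t ∈ closure D) (hP0 : P 0 ∈ D) (hP1 : P 1 ∈ D)
    (he0 : 0 < e) (he1 : e ≤ 1 / 2)
    (hA : ∀ z, A z = (‖z‖ : ℂ) * Complex.exp (Complex.I * ((e : ℂ) +
      (1 - 2 * (e : ℂ) / (Real.pi : ℂ)) * (Complex.arg z : ℂ))))
    (hτ0 : 0 ≤ τ) (hPtail : ∀ t : I, τ ≤ (t : ℝ) → P t = P 1) {c : ℂ} (hc : c ∈ Z '' Icc i j)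
    (hu : u₁ = sInf {u | u ∈ Icc i j ∧ Z u = c}) :
    u₁ ∈ Icc i j ∧ Z u₁ = c ∧ (∀ u ∈ Icc i j, Z u = c → u₁ ≤ u) ∧ u₁ ≤ τ := by
  have hRcl : ∀ u, R u ∈ closure D := trim_R_mem hR hPcl
  have hZc := sqd_Z_continuousOn hR hZ hi hj hψ hΦc hΦb hΦinf hsurj hψc hRcl hbD hP0 he0 he1 hA
  set U : Set ℝ := {u | u ∈ Icc i j ∧ Z u = c} with hU
  have hUc : IsClosed U := hZc.preimage_isClosed_of_isClosed isClosed_Icc isClosed_singleton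
  obtain ⟨u₀, hu₀, rfl⟩ := hc
  have hne : U.Nonempty := ⟨u₀, hu₀, rfl⟩
  have hbdd : BddBelow U := ⟨i, fun u hu => hu.1.1⟩
  have hmem : u₁ ∈ U := hu ▸ hUc.csInf_mem hne hbdd
  have hmin : ∀ u ∈ Icc i j, Z u = Z u₀ → u₁ ≤ u := fun u hu' huc =>
    hu ▸ csInf_le hbdd ⟨hu', huc⟩
  refine ⟨hmem.1, hmem.2, hmin, ?_⟩
  by_contra hτu
  rw [not_le] at hτu
  have hiτ : i ≤ τ := trim_i_le_tau hR hi hτ0 hPtail haD hP1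
  have hτU : Z τ = Z u₀ := by
    rw [← hmem.2, sqd_Z_tail hR hZ hτ0 hPtail le_rfl, sqd_Z_tail hR hZ hτ0 hPtail hτu.le]
  have := hmin τ ⟨hiτ, hτu.le.trans hmem.1.2⟩ hτU
  linarith

/-! ### The exit anchor `q` and the exit parameter `r₁` -/

/-- When the polyline does not visit `b` (`R j ≠ b`): `q = A (ψ (R j))` lies in the open
half-plane, has the norm of `ψ (P 1)`, and `Z j = Φ q`. [folklore] -/
theorem anc_q_spec (hR : ∀ u, R u = P (projIcc 0 1 zero_le_one u))
    (hZ : ∀ u, Z u = @ite ℂ (R u = b) (Classical.propDecidable _) b (Φ (A (ψ (R u)))))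
    (hj : j = sInf ({(1 : ℝ)} ∪ {u | u ∈ Icc (0 : ℝ) 1 ∧ R u = b}))
    (hψ : ψ = invFunOn Φ {z : ℂ | 0 ≤ z.im}) (hΦi : InjOn Φ {z : ℂ | 0 ≤ z.im})
    (hsurj : closure D \ {b} ⊆ Φ '' {z : ℂ | 0 ≤ z.im}) (hΦ0 : Φ 0 = a) (haD : a ∉ D)
    (hPcl : ∀ t, P t ∈ closure D) (hP1 : P 1 ∈ D) (he0 : 0 < e) (he1 : e ≤ 1 / 2)
    (hA : ∀ z, A z = (‖z‖ : ℂ) * Complex.exp (Complex.I * ((e : ℂ) +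
      (1 - 2 * (e : ℂ) / (Real.pi : ℂ)) * (Complex.arg z : ℂ)))) (hq : q = A (ψ (R j)))
    (hRj : R j ≠ b) :
    0 < q.im ∧ ‖q‖ = ‖ψ (P 1)‖ ∧ Z j = Φ q := by
  have hRcl : ∀ u, R u ∈ closure D := trim_R_mem hR hPcl
  have hRj1 : R j = P 1 := by
    rcases trim_R_j hR hj with h | ⟨-, h⟩
    · exact absurd h hRj
    · exact h
  obtain ⟨him, -⟩ := sqd_psi_R hψ hsurj hRcl hRj
  have hne : ψ (R j) ≠ 0 := by
    subst hψ
    intro h0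
    have := (inv_eq_zero_iff hΦi hsurj hΦ0 ⟨hRcl j, hRj⟩).1 h0
    rw [hRj1] at this
    exact haD (this ▸ hP1)
  subst hq
  exact ⟨sqz_im_pos he0 he1 hA him hne, by rw [sqz_norm hA, hRj1], sqd_Z_of_ne hZ hRj⟩

/-- **The exit parameter `r₁` is attained**: `1 ≤ r₁`; if the polyline visits `b` then
`r₁ = 1`; otherwise `Φ (r₁ q) ∈ M` and no later parameter hits `M`. [folklore] -/
theorem anc_r_spec (hR : ∀ u, R u = P (projIcc 0 1 zero_le_one u))
    (hZ : ∀ u, Z u = @ite ℂ (R u = b) (Classical.propDecidable _) b (Φ (A (ψ (R u)))))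
    (hi : i = sSup ({(0 : ℝ)} ∪ {u | u ∈ Icc (0 : ℝ) 1 ∧ R u = a}))
    (hj : j = sInf ({(1 : ℝ)} ∪ {u | u ∈ Icc (0 : ℝ) 1 ∧ R u = b}))
    (hψ : ψ = invFunOn Φ {z : ℂ | 0 ≤ z.im}) (hΦc : ContinuousOn Φ {z : ℂ | 0 ≤ z.im})
    (hΦi : InjOn Φ {z : ℂ | 0 ≤ z.im})
    (hΦb : ∀ z : ℂ, 0 ≤ z.im → Φ z ≠ b)
    (hΦinf : Tendsto Φ (cocompact ℂ ⊓ 𝓟 {z : ℂ | 0 ≤ z.im}) (𝓝 b))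
    (hsurj : closure D \ {b} ⊆ Φ '' {z : ℂ | 0 ≤ z.im}) (hΦ0 : Φ 0 = a)
    (hψc : ContinuousOn ψ (closure D \ {b})) (haD : a ∉ D)
    (hbD : b ∉ D) (hPcl : ∀ t, P t ∈ closure D) (hP0 : P 0 ∈ D) (hP1 : P 1 ∈ D)
    (he0 : 0 < e) (he1 : e ≤ 1 / 2)
    (hA : ∀ z, A z = (‖z‖ : ℂ) * Complex.exp (Complex.I * ((e : ℂ) +
      (1 - 2 * (e : ℂ) / (Real.pi : ℂ)) * (Complex.arg z : ℂ)))) (hij : i ≤ j)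
    (hq : q = A (ψ (R j)))
    (hr : r₁ = sSup ({(1 : ℝ)} ∪ {r | 1 ≤ r ∧ R j ≠ b ∧ Φ ((r : ℂ) * q) ∈ Z '' Icc i j})) :
    1 ≤ r₁ ∧ (R j = b → r₁ = 1) ∧
      (R j ≠ b → Φ ((r₁ : ℂ) * q) ∈ Z '' Icc i j ∧
        ∀ r : ℝ, r₁ < r → Φ ((r : ℂ) * q) ∉ Z '' Icc i j) := by
  have hRcl : ∀ u, R u ∈ closure D := trim_R_mem hR hPcl
  by_cases hRj : R j = b
  · have hset : {r : ℝ | 1 ≤ r ∧ R j ≠ b ∧ Φ ((r : ℂ) * q) ∈ Z '' Icc i j} = ∅ := by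
      ext r; simp [hRj]
    have hr1 : r₁ = 1 := by rw [hr, hset, union_empty, csSup_singleton]
    exact ⟨hr1.ge, fun _ => hr1, fun h => absurd hRj h⟩
  · obtain ⟨hqim, -, hZj⟩ := anc_q_spec hR hZ hj hψ hΦi hsurj hΦ0 haD hPcl hP1 he0 he1 hA hq hRj
    have hMc : IsClosed (Z '' Icc i j) :=
      (isCompact_Icc.image_of_continuousOn (sqd_Z_continuousOn hR hZ hi hj hψ hΦc hΦb hΦinf
        hsurj hψc hRcl hbD hP0 he0 he1 hA)).isClosed
    have hbM : b ∉ Z '' Icc i j :=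
      sqd_b_not_mem_M hR hZ hi hj hψ hsurj hRcl he0 he1 hA hΦb hRj
    set g : ℝ → ℂ := fun r => Φ ((r : ℂ) * q) with hg
    have hgc : ContinuousOn g (Ici 0) := ray_continuousOn hΦc hqim.le
    -- far along the ray we are close to `b`, hence off `M`
    obtain ⟨N, hN⟩ : ∃ N, ∀ r, N ≤ r → g r ∉ Z '' Icc i j := by
      have h := (ray_tendsto_pt hΦinf hqim.le (fun h0 => by rw [h0] at hqim; simp at hqim))
        (hMc.isOpen_compl.mem_nhds hbM)
      obtain ⟨N, hN⟩ := eventually_atTop.1 h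
      exact ⟨N, fun r hr => hN r hr⟩
    set T : Set ℝ := {r | 1 ≤ r ∧ R j ≠ b ∧ Φ ((r : ℂ) * q) ∈ Z '' Icc i j} with hT
    have h1T : (1 : ℝ) ∈ T := ⟨le_rfl, hRj, by
      rw [Complex.ofReal_one, one_mul, ← hZj]; exact ⟨j, ⟨hij, le_rfl⟩, rfl⟩⟩
    have hTeq : T = Ici 1 ∩ g ⁻¹' (Z '' Icc i j) := by
      ext r; exact ⟨fun h => ⟨h.1, h.2.2⟩, fun h => ⟨h.1, hRj, h.2⟩⟩
    have hTc : IsClosed T := by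
      rw [hTeq]
      exact (hgc.mono (Ici_subset_Ici.2 zero_le_one)).preimage_isClosed_of_isClosed isClosed_Ici hMc
    have hbdd : BddAbove T := ⟨N, fun r hr => by
      by_contra h; exact hN r (not_le.1 h).le hr.2.2⟩
    have hunion : {(1 : ℝ)} ∪ T = T := union_eq_right.2 (singleton_subset_iff.2 h1T)
    have hr' : r₁ = sSup T := by rw [hr, hunion]
    have hmem : r₁ ∈ T := hr' ▸ hTc.csSup_mem ⟨1, h1T⟩ hbdd
    refine ⟨hmem.1, fun h => absurd h hRj, fun _ => ⟨hmem.2.2, fun r hlt hrM => ?_⟩⟩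
    have : r ≤ r₁ := hr' ▸ le_csSup hbdd ⟨hmem.1.trans hlt.le, hRj, hrM⟩
    linarith

/-- **The cut time `v₁` is attained**: `v₁ ∈ [i, j]`; if the polyline visits `b` then `v₁ = j`
(and `Z v₁ = b`); otherwise `Z v₁ = Φ (r₁ q)` and `v₁` is the last such time. [folklore] -/
theorem anc_v_spec (hR : ∀ u, R u = P (projIcc 0 1 zero_le_one u))
    (hZ : ∀ u, Z u = @ite ℂ (R u = b) (Classical.propDecidable _) b (Φ (A (ψ (R u)))))
    (hi : i = sSup ({(0 : ℝ)} ∪ {u | u ∈ Icc (0 : ℝ) 1 ∧ R u = a}))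
    (hj : j = sInf ({(1 : ℝ)} ∪ {u | u ∈ Icc (0 : ℝ) 1 ∧ R u = b}))
    (hψ : ψ = invFunOn Φ {z : ℂ | 0 ≤ z.im}) (hΦc : ContinuousOn Φ {z : ℂ | 0 ≤ z.im})
    (hΦb : ∀ z : ℂ, 0 ≤ z.im → Φ z ≠ b)
    (hΦinf : Tendsto Φ (cocompact ℂ ⊓ 𝓟 {z : ℂ | 0 ≤ z.im}) (𝓝 b))
    (hsurj : closure D \ {b} ⊆ Φ '' {z : ℂ | 0 ≤ z.im})
    (hψc : ContinuousOn ψ (closure D \ {b}))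
    (hbD : b ∉ D) (hPcl : ∀ t, P t ∈ closure D) (hP0 : P 0 ∈ D)
    (he0 : 0 < e) (he1 : e ≤ 1 / 2)
    (hA : ∀ z, A z = (‖z‖ : ℂ) * Complex.exp (Complex.I * ((e : ℂ) +
      (1 - 2 * (e : ℂ) / (Real.pi : ℂ)) * (Complex.arg z : ℂ)))) (hij : i ≤ j) {c : ℂ}
    (hc : R j ≠ b → c ∈ Z '' Icc i j)
    (hv : v₁ = sSup ({u | u ∈ Icc i j ∧ R j = b ∧ u = j} ∪ {u | u ∈ Icc i j ∧ R j ≠ b ∧ Z u = c})) :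
    v₁ ∈ Icc i j ∧ (R j = b → v₁ = j) ∧
      (R j ≠ b → Z v₁ = c ∧ ∀ u ∈ Icc i j, Z u = c → u ≤ v₁) := by
  have hRcl : ∀ u, R u ∈ closure D := trim_R_mem hR hPcl
  by_cases hRj : R j = b
  · have hset : ({u | u ∈ Icc i j ∧ R j = b ∧ u = j} ∪ {u | u ∈ Icc i j ∧ R j ≠ b ∧ Z u = c}) =
        {j} := by
      ext u
      simp only [mem_union, mem_setOf_eq, hRj, ne_eq, not_true_eq_false, false_and, and_false,
        or_false, true_and, mem_singleton_iff, mem_Icc]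
      exact ⟨fun h => h.2, fun h => ⟨⟨h ▸ hij, h.le⟩, h⟩⟩
    have hvj : v₁ = j := by rw [hv, hset, csSup_singleton]
    exact ⟨by rw [hvj]; exact ⟨hij, le_rfl⟩, fun _ => hvj, fun h => absurd hRj h⟩
  · have hZc := sqd_Z_continuousOn hR hZ hi hj hψ hΦc hΦb hΦinf hsurj hψc hRcl hbD hP0 he0 he1 hA
    have hset : ({u | u ∈ Icc i j ∧ R j = b ∧ u = j} ∪ {u | u ∈ Icc i j ∧ R j ≠ b ∧ Z u = c}) =
        {u | u ∈ Icc i j ∧ Z u = c} := by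
      ext u
      simp only [mem_union, mem_setOf_eq, hRj, false_and, and_false, false_or, ne_eq,
        not_false_eq_true, true_and]
    set V : Set ℝ := {u | u ∈ Icc i j ∧ Z u = c} with hV
    have hVc : IsClosed V := hZc.preimage_isClosed_of_isClosed isClosed_Icc isClosed_singleton
    obtain ⟨u₀, hu₀, hu₀c⟩ := hc hRj
    have hne : V.Nonempty := ⟨u₀, hu₀, hu₀c⟩
    have hbdd : BddAbove V := ⟨j, fun u hu => hu.1.2⟩
    have hv' : v₁ = sSup V := by rw [hv, hset]
    have hmem : v₁ ∈ V := hv' ▸ hVc.csSup_mem hne hbdd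
    exact ⟨hmem.1, fun h => absurd h hRj, fun _ => ⟨hmem.2, fun u hu huc =>
      hv' ▸ le_csSup hbdd ⟨hu, huc⟩⟩⟩

/-- **Reduction of the middle piece**: if `u₁ ≤ τ` and `u₁ ≤ v₁`, then with `v' = min v₁ τ` one
has `u₁ ≤ v'`, `Z([u₁, v₁]) = Z([u₁, v'])` and `Z v' = Z v₁`. [folklore] -/
theorem anc_middle_eq (hR : ∀ u, R u = P (projIcc 0 1 zero_le_one u))
    (hZ : ∀ u, Z u = @ite ℂ (R u = b) (Classical.propDecidable _) b (Φ (A (ψ (R u)))))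
    (hτ0 : 0 ≤ τ) (hPtail : ∀ t : I, τ ≤ (t : ℝ) → P t = P 1) (hu : u₁ ≤ τ) (huv : u₁ ≤ v₁) :
    u₁ ≤ min v₁ τ ∧ Z '' Icc u₁ v₁ = Z '' Icc u₁ (min v₁ τ) ∧ Z (min v₁ τ) = Z v₁ := by
  refine ⟨le_min huv hu, ?_, ?_⟩
  · apply Subset.antisymm
    · rintro _ ⟨u, hu', rfl⟩
      rcases le_or_gt u τ with hut | hut
      · exact ⟨u, ⟨hu'.1, le_min hu'.2 hut⟩, rfl⟩
      · refine ⟨τ, ⟨hu, le_min (hut.le.trans hu'.2) le_rfl⟩, ?_⟩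
        rw [sqd_Z_tail hR hZ hτ0 hPtail le_rfl, sqd_Z_tail hR hZ hτ0 hPtail hut.le]
    · exact image_mono (Icc_subset_Icc_right (min_le_left _ _))
  · rcases le_or_gt v₁ τ with h | h
    · rw [min_eq_left h]
    · rw [min_eq_right h.le, sqd_Z_tail hR hZ hτ0 hPtail le_rfl, sqd_Z_tail hR hZ hτ0 hPtail h.le]

end Summit.CriticalPhenomena.SAWScalingLimit.Theorems
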